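/-
Copyright (c) 2026 the pub-hodgecm-mathlib formalisation cell (harness21).  Prover seat hodgecm-mathlib-K2E2-p12 (g9), Track B «K2-LIT», h413 = `stmt-HodgeConjecture-24833`,
R90-TF section S8 «ContSpec-n½», the χ POLE LEDGER's (C4) face (census `R90/S8/CENSUS-PoleSetShrink.K2E2-p12-g9.md` cfbdda50b83e364d): «(E6) AT REMOVED CANDIDATE POLES» —
the exports' truncated `L²` family extends holomorphically across every removable candidate pole WITH THE RIGHT a.e. VALUE, so the candidate pole set `P` may be SHRUNK to `P ∖ R`
in ★ (C4) `hCONT_of_truncatedFamily_exports`'s inputs `hEdiff′ hE6′`, making its pole-ledger letter `hPS` hold by construction.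
-/
import Summits.HodgeConjecture.HodgeConjecture.Theorems.K2E1ChiContinuedEisensteinMiddleResidueCMThree   -- ★ (K2E1-p16) `truncation_apply_of_isMax` (Siegel-top formula at the maximiser); brings ★ BL-R1₃ `exists_forall_borelHeight_mul_le`, `truncation`, `borelConstantTerm`
import Summits.HodgeConjecture.HodgeConjecture.Theorems.K2E1ChiConstantTermHolomorphicCMThree           -- ★ (K2E1-p15) `differentiableOn_borelConstantTerm_family` ((E1)_B: the constant term of a family with rows `hEd hE4 hEbd` is holomorphic in `z`)
import Mathlib.Analysis.Complex.RemovableSingularity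
import Mathlib.MeasureTheory.Function.ConvergenceInMeasure
import HarnessLib

/-!
# h413 ∕ R90-S8 — `K2E1ChiTruncatedFamilyRemovableCMThree`: (E6) AT REMOVED CANDIDATE POLES — THE TRUNCATED `L²` FAMILY EXTENDS HOLOMORPHICALLY, WITH THE RIGHT a.e. VALUE, ACROSS
# EVERY CANDIDATE POLE WHERE IT IS `L²`-BOUNDED AND THE CONTINUED FAMILY CARRIES THE LEDGER'S ROWS (pole-set shrink for ★ (C4))

Cell `pub/hodgecm-mathlib`, crux H413 = `stmt-HodgeConjecture-24833`, route `HCCMUnconditional`; R90-TF section S8.  THEOREMS ONLY (no `def`, no `instance`, no notation, no named-fact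
hypothesis, no `sorry`; default heartbeats); lane `--supports stmt-HodgeConjecture-24833 --as helper` (count-neutral).  Closes no socket.

WHY.  ★ (C4) `hCONT_of_truncatedFamily_exports` (K2E1-p10) consumes the χ pole ledger as `hPS : P ∩ {1 < Re} ⊆ ↑S` (`S` finite real) for the EXPORTS' candidate pole set `P` — any closed
co-discrete set `⊆ {Re ≤ 2}` produced by the Bernstein–Lapid linear systems; a removable candidate is still a member of `P`, so `hPS` is not a statement one proves about `P` as printed.
Its honest content is a POLE-SET SHRINK: replace `P` by `P ∖ R` (`R` = the candidates shown removable) in (C4)'s two inputs `hEdiff′ : ∀ g, DifferentiableOn ℂ (Ec′ · g) Pᶜ` and (E6)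
`hE6′ : ∃ Fam, DifferentiableOn ℂ Fam Pᶜ ∧ ∀ z ∉ P, Fam z =ᵐ quotFun (Λ^T (Ec′ z))`.  For `Ec′ · g` this is ★ `K2E1ChiEisensteinPoleLedgerCMThree` (Riemann in normal form).  For the
`L²`-VALUED family it is THIS FILE: (i) RIEMANN'S REMOVABLE-SINGULARITY THEOREM IN A BANACH SPACE (Mathlib `Complex.differentiableOn_update_limUnder_of_bddAbove`, `L²` complete) — from
the `L²` bound (MS-P′) `‖Fam z‖ ≤ C` near `z₀`, the very letter the ledger already carries, `Fam` has a limit `Fam* z₀` along `𝓝[≠] z₀` and `update Fam z₀ (Fam* z₀)` is holomorphic near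
`z₀`; (ii) THE VALUE IS THE RIGHT ONE, `Fam* z₀ =ᵐ quotFun (Λ^T (Ec z₀))`: `L²`-convergence gives an a.e.-convergent subsequence (convergence in measure, Mathlib
`TendstoInMeasure.exists_seq_tendsto_ae'`), and POINTWISE `z ↦ Λ^T(Ec z)(y)` is continuous (indeed holomorphic) at `z₀` — by the Siegel-top formula at the maximiser `γ₀` of `y` (★
`truncation_apply_of_isMax`: `Λ^T u(y) = u(y) − 𝟙[T < H(γ₀y)]·u_B(γ₀y)`, `T ≥ 1`, `u` left-`G(F)`-invariant) and the holomorphy of the constant term of a family carrying the rows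
`hEd hE4 hEbd` (★ `differentiableOn_borelConstantTerm_family`, dominated convergence over the compact `closure 𝓕`) — so the two limits agree a.e.  NO cusp-decay letter, NO sup bound of the
truncation, NO (D2): uniqueness of a.e. limits does the identification.
* §1 (generic Banach ∕ `Lp`) **`differentiableAt_update_limUnder_of_eventually_bounded`**, **`tendsto_limUnder_of_eventually_bounded`** (Mathlib's removable singularity from an EVENTUAL
  bound), **`coeFn_limUnder_ae_eq_of_ae_tendsto`** (the `Lp`-limit's a.e. value from a.e. rows + a.e. pointwise continuity).
* §2 (generic quadratic `(F, E, c)`, `N = 3`) **`differentiableOn_truncation_apply_of_rows`** — `z ↦ Λ^T(Ec z)(y)` is holomorphic on any open `U` carrying `hEd hE4 hEbd hEcinv`, `T ≥ 1`.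
* §3 (generic quadratic, `N = 3`) HEAD **`truncatedFamily_removable_of_rows`** — `P` closed & co-discrete, `Fam : ℂ → Lp ℂ 2 μ` holomorphic on `Pᶜ` with a.e. rows off `P`, `R ⊆ P ∩ U`,
  `U` open with the rows, (MS-P′) on `R` ⊢ `∃ Fam′, DifferentiableOn ℂ Fam′ (P ∖ R)ᶜ ∧ ∀ z ∉ P ∖ R, Fam′ z =ᵐ[μ] quotFun (Λ^T (Ec z))` — (C4)'s `hE6′` conjunct for `P ∖ R`;
  **`isClosed_diff_of_subset_open`**-style bookkeeping `poleSet_shrink_clauses` (`P ∖ R` closed if `R = P ∩ U`, co-discrete, `⊆ {Re ≤ 2}`).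
LETTERS (visible, per removed point): the ledger's rows on `U` (★ p863972 at `U := {1<Re} ∖ {3∕2}`, themselves of (B-P-K)) and (MS-P′).  After this file ★ (C4) runs VERBATIM with
`P ∖ R`, and `hPS` reads «every candidate pole of `{1 < Re}` off `S ∪ {3∕2}` is removable in the joint + `L²` sense» = {(MS-P′)+(a′) off-axis (M, K2E1-p16), R7₃ on-axis (L, unowned)}.
HONEST LABEL: HC_CM is proved only modulo the 7 printed citations (2 remaining named inputs: hLiu418 = `stmt-HodgeConjecture-24832`, h413 = `stmt-HodgeConjecture-24833`) until rung 0
closes; this file asserts no named fact, closes no socket, and does not claim that any candidate pole IS removable; count-neutral.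

## References
* [MoeglinWaldspurger1995] C. Mœglin, J.-L. Waldspurger, *Spectral Decomposition and Eisenstein Series* (1995), I.2.13, IV.1.9–IV.1.11, IV.2.3.
* [BernsteinLapid2019] J. Bernstein, E. Lapid, *On the meromorphic continuation of Eisenstein series*, J. AMS 37 (2024), Thm 2.3, §4 p. 10.
* [Arthur1980TraceFormulaII] J. Arthur, *A trace formula for reductive groups II*, Compos. Math. 40 (1980), §1.
* [Conway1978] J. B. Conway, *Functions of One Complex Variable I*, 2nd ed. (1978), V §1 (removable singularities).
-/

set_option autoImplicit false
set_option linter.dupNamespace false  -- the mandated namespace repeats the summit's segment (`HodgeConjecture.HodgeConjecture`)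

noncomputable section

open MeasureTheory Measure NumberField IsDedekindDomain Set Filter Topology Function
open scoped ENNReal NNReal
open Literature.NumberTheory.Automorphic Literature.NumberTheory.Automorphic.UnitaryGroup AdelicGroupData
open Summit.HodgeConjecture.HodgeConjecture.Cruxes.H413.K2E1ChiContinuedEisensteinMiddleResidueCMThree (truncation_apply_of_isMax)
open Summit.HodgeConjecture.HodgeConjecture.Cruxes.H413.K2E1ChiConstantTermHolomorphicCMThree (differentiableOn_borelConstantTerm_family)
open Summit.HodgeConjecture.HodgeConjecture.Cruxes.H413.K2E1BLHeightCosetsU3 (exists_forall_borelHeight_mul_le)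

namespace Summit.HodgeConjecture.HodgeConjecture.Cruxes.H413.K2E1ChiTruncatedFamilyRemovableCMThree

/-! ## §1 Removable singularities of Banach-valued maps from an eventual bound; the a.e. value of an `Lp`-limit -/

section Generic

variable {B : Type*} [NormedAddCommGroup B] [NormedSpace ℂ B] [CompleteSpace B]

/-- **REMOVABLE SINGULARITY FROM AN EVENTUAL BOUND** (Mathlib's `Complex.differentiableOn_update_limUnder_of_bddAbove` on the neighbourhood where the bound holds): a Banach-valued `f`,
complex differentiable and bounded on a punctured neighbourhood of `c`, redefined at `c` by its punctured limit, is differentiable AT `c`. [cite: Conway1978, V §1] -/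
theorem differentiableAt_update_limUnder_of_eventually_bounded {f : ℂ → B} {c : ℂ}
    (hda : ∀ᶠ z in 𝓝[≠] c, DifferentiableAt ℂ f z) (hb : ∃ C : ℝ, ∀ᶠ z in 𝓝[≠] c, ‖f z‖ ≤ C) :
    DifferentiableAt ℂ (update f c (limUnder (𝓝[≠] c) f)) c := by
  obtain ⟨C, hC⟩ := hb
  have hs : {z : ℂ | z ≠ c → DifferentiableAt ℂ f z ∧ ‖f z‖ ≤ C} ∈ 𝓝 c := eventually_nhdsWithin_iff.1 (hda.and hC)
  have H := Complex.differentiableOn_update_limUnder_of_bddAbove hs (fun z hz => (hz.1 hz.2).1.differentiableWithinAt)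
    ⟨C, by rintro _ ⟨z, hz, rfl⟩; exact (hz.1 hz.2).2⟩
  exact H.differentiableAt hs

/-- **THE PUNCTURED LIMIT EXISTS** under the same hypotheses (Mathlib's `Complex.tendsto_limUnder_of_differentiable_on_punctured_nhds_of_bounded_under`). [cite: Conway1978, V §1] -/
theorem tendsto_limUnder_of_eventually_bounded {f : ℂ → B} {c : ℂ}
    (hda : ∀ᶠ z in 𝓝[≠] c, DifferentiableAt ℂ f z) (hb : ∃ C : ℝ, ∀ᶠ z in 𝓝[≠] c, ‖f z‖ ≤ C) :
    Tendsto f (𝓝[≠] c) (𝓝 (limUnder (𝓝[≠] c) f)) := by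
  obtain ⟨C, hC⟩ := hb
  refine Complex.tendsto_limUnder_of_differentiable_on_punctured_nhds_of_bounded_under hda ⟨C + ‖f c‖, ?_⟩
  rw [eventually_map]
  exact hC.mono fun z hz => (norm_sub_le _ _).trans (add_le_add hz le_rfl)

variable {α : Type*} [MeasurableSpace α] {μ : Measure α} {p : ℝ≥0∞} [Fact (1 ≤ p)]

/-- **THE a.e. VALUE OF THE `Lp`-LIMIT**: if `Fam : ℂ → Lp` is differentiable and bounded on a punctured neighbourhood of `c`, represents `F z` a.e. for `z` near `c` (`z ≠ c`), and for a.e.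
`x` the scalar `z ↦ F z x` tends to `F c x` along `𝓝[≠] c`, then the punctured `Lp`-limit of `Fam` at `c` represents `F c` a.e.  PROOF: `Lp`-convergence ⇒ convergence in measure ⇒ an
a.e.-convergent subsequence along some `z_n → c` (Mathlib `TendstoInMeasure.exists_seq_tendsto_ae'`); along it `Fam (z_n) x = F (z_n) x → F c x` a.e.; limits are unique. [cite: Conway1978, V §1] -/
theorem coeFn_limUnder_ae_eq_of_ae_tendsto (Fam : ℂ → Lp B p μ) {c : ℂ}
    (hda : ∀ᶠ z in 𝓝[≠] c, DifferentiableAt ℂ Fam z) (hb : ∃ C : ℝ, ∀ᶠ z in 𝓝[≠] c, ‖Fam z‖ ≤ C)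
    (F : ℂ → α → B) (hFam : ∀ᶠ z in 𝓝[≠] c, ((Fam z : Lp B p μ) : α → B) =ᵐ[μ] F z)
    (hptw : ∀ᵐ x ∂μ, Tendsto (fun z => F z x) (𝓝[≠] c) (𝓝 (F c x))) :
    ((limUnder (𝓝[≠] c) Fam : Lp B p μ) : α → B) =ᵐ[μ] F c := by
  have hlim : Tendsto Fam (𝓝[≠] c) (𝓝 (limUnder (𝓝[≠] c) Fam)) := tendsto_limUnder_of_eventually_bounded hda hb
  have hmeas : TendstoInMeasure μ (fun z => ((Fam z : Lp B p μ) : α → B)) (𝓝[≠] c) ((limUnder (𝓝[≠] c) Fam : Lp B p μ) : α → B) :=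
    tendstoInMeasure_of_tendsto_Lp hlim
  obtain ⟨ns, hns, hae⟩ := hmeas.exists_seq_tendsto_ae'
  obtain ⟨N, hN⟩ := eventually_atTop.1 (hns.eventually hFam)
  have hae2 : ∀ᵐ x ∂μ, ∀ i, N ≤ i → ((Fam (ns i) : Lp B p μ) : α → B) x = F (ns i) x := by
    rw [ae_all_iff]
    intro i
    by_cases hi : N ≤ i
    · filter_upwards [hN i hi] with x hx _ using hx
    · exact ae_of_all _ fun x h => absurd h hi
  filter_upwards [hae, hae2, hptw] with x hx hx2 hx3
  have h1 : Tendsto (fun i => F (ns i) x) atTop (𝓝 (((limUnder (𝓝[≠] c) Fam : Lp B p μ) : α → B) x)) :=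
    hx.congr' (eventually_atTop.2 ⟨N, fun i hi => hx2 i hi⟩)
  exact tendsto_nhds_unique h1 (hx3.comp hns)

end Generic

/-! ## §2 Pointwise holomorphy of the truncation of a family carrying the ledger's rows -/

section Truncation

variable {F E : Type} [Field F] [NumberField F] [Field E] [NumberField E] [Algebra F E] {c : E ≃ₐ[F] E}
variable [MeasurableSpace (quasiSplit F E c 3).Adelic] [BorelSpace (quasiSplit F E c 3).Adelic]

/-- **`z ↦ Λ^T(Ec z)(y)` IS HOLOMORPHIC ON `U`** (`T ≥ 1`; `U` open carrying the rows `hEd` (holomorphy per `g`), `hE4` (continuity in `g`), `hEbd` (joint local bound), `hEcinv` (left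
`G(F)`-invariance); `ν` Haar, `𝓕` a fundamental domain of `N(F)` of compact closure): at the maximiser `γ₀` of `y` (★ BL-R1₃) the Siegel-top formula ★ `truncation_apply_of_isMax` writes
`Λ^T(Ec z)(y) = Ec z y − 𝟙[T < H(γ₀y)]·(Ec z)_B(γ₀y)`, and the constant term of the family is holomorphic in `z` (★ `differentiableOn_borelConstantTerm_family`).
[cite: MoeglinWaldspurger1995, I.2.13, IV.1.9] [cite: Arthur1980TraceFormulaII, §1] -/
theorem differentiableOn_truncation_apply_of_rows (ν : Measure ↥(adelicUnipotent F E c 3)) [ν.IsHaarMeasure] {𝓕 : Set ↥(adelicUnipotent F E c 3)}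
    (h𝓕 : IsFundamentalDomain ↥(rationalUnipotent F E c 3) 𝓕 ν) (h𝓕c : IsCompact (closure 𝓕)) {T : ℝ≥0} (hT : 1 ≤ T)
    (Ec : ℂ → (quasiSplit F E c 3).Adelic → ℂ) {U : Set ℂ} (hUo : IsOpen U)
    (hEd : ∀ g, DifferentiableOn ℂ (fun z => Ec z g) U) (hE4 : ∀ z ∈ U, Continuous (Ec z))
    (hEbd : ∀ z₀ ∈ U, ∀ K : Set (quasiSplit F E c 3).Adelic, IsCompact K → ∃ V ∈ 𝓝 z₀, ∃ M : ℝ, ∀ z ∈ V, ∀ g ∈ K, ‖Ec z g‖ ≤ M)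
    (hEcinv : ∀ z ∈ U, ∀ (γ : (quasiSplit F E c 3).arithmeticSubgroup) (x : (quasiSplit F E c 3).Adelic), Ec z ((γ : (quasiSplit F E c 3).Adelic) * x) = Ec z x)
    (y : (quasiSplit F E c 3).Adelic) :
    DifferentiableOn ℂ (fun z => truncation ν 𝓕 T (Ec z) y) U := by
  obtain ⟨γ₀, hγ₀⟩ := exists_forall_borelHeight_mul_le (F := F) (E := E) (c := c) y
  have h𝓕top : ν 𝓕 ≠ ∞ := ((measure_mono subset_closure).trans_lt h𝓕c.measure_lt_top).ne
  have hB : DifferentiableOn ℂ (fun z => borelConstantTerm ν 𝓕 (Ec z) ((γ₀ : (quasiSplit F E c 3).Adelic) * y)) U :=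
    differentiableOn_borelConstantTerm_family ν h𝓕.nullMeasurableSet h𝓕top h𝓕c Ec hUo hEd hE4 hEbd _
  have hform : ∀ z ∈ U, truncation ν 𝓕 T (Ec z) y = Ec z y - if T < borelHeight ((γ₀ : (quasiSplit F E c 3).Adelic) * y) then
      borelConstantTerm ν 𝓕 (Ec z) ((γ₀ : (quasiSplit F E c 3).Adelic) * y) else 0 := fun z hz =>
    truncation_apply_of_isMax ν h𝓕 hT (hEcinv z hz) y γ₀ hγ₀
  refine DifferentiableOn.congr ?_ hform
  by_cases hlt : T < borelHeight ((γ₀ : (quasiSplit F E c 3).Adelic) * y)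
  · simp only [if_pos hlt]; exact (hEd y).sub hB
  · simp only [if_neg hlt, sub_zero]; exact hEd y

end Truncation

/-! ## §3 HEAD: the truncated `L²` family across removable candidate poles (pole-set shrink for ★ (C4)) -/

section Shrink

variable {F E : Type} [Field F] [NumberField F] [Field E] [NumberField E] [Algebra F E] {c : E ≃ₐ[F] E}
variable [MeasurableSpace (quasiSplit F E c 3).Adelic] [BorelSpace (quasiSplit F E c 3).Adelic]

/-- **(E6) AT REMOVED CANDIDATE POLES — THE POLE-SET SHRINK** (HEAD; module docstring).  `P` closed and co-discrete; `Fam : ℂ → Lp ℂ 2 μ` holomorphic on `Pᶜ` with the a.e. rows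
`Fam z =ᵐ quotFun (Λ^T (Ec z))` off `P` (★ (C2b)'s (E6) conjunct); `U` open carrying the ledger's rows `hEd hE4 hEbd hEcinv` (★ p863972 at `U := {1<Re} ∖ {3∕2}`); `R ⊆ P ∩ U` the set of
candidates to remove, each with the `L²` letter (MS-P′) `∃ C, ∀ᶠ z in 𝓝[≠] z₀, ‖Fam z‖ ≤ C`.  THEN the family redefined on `R` by its punctured `L²`-limits is holomorphic on `(P ∖ R)ᶜ` and
represents `quotFun (Λ^T (Ec z))` a.e. at EVERY `z ∉ P ∖ R` (§1 (i) Riemann in `L²`; (ii) the a.e. value by §2 + uniqueness of a.e. limits).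
[cite: MoeglinWaldspurger1995, IV.1.9–IV.1.11, IV.2.3] [cite: BernsteinLapid2019, Thm 2.3, §4 p. 10] [cite: Conway1978, V §1] -/
theorem truncatedFamily_removable_of_rows (μ : Measure (quasiSplit F E c 3).automorphicQuotient)
    (ν : Measure ↥(adelicUnipotent F E c 3)) [ν.IsHaarMeasure] {𝓕 : Set ↥(adelicUnipotent F E c 3)}
    (h𝓕 : IsFundamentalDomain ↥(rationalUnipotent F E c 3) 𝓕 ν) (h𝓕c : IsCompact (closure 𝓕)) {T : ℝ≥0} (hT : 1 ≤ T)
    (Ec : ℂ → (quasiSplit F E c 3).Adelic → ℂ) {P : Set ℂ} (hPc : IsClosed P) (hPcd : ∀ z₀ : ℂ, ∀ᶠ s in 𝓝[≠] z₀, s ∉ P)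
    (Fam : ℂ → Lp ℂ 2 μ) (hFd : DifferentiableOn ℂ Fam Pᶜ)
    (hFam : ∀ z : ℂ, z ∉ P → ((Fam z : Lp ℂ 2 μ) : (quasiSplit F E c 3).automorphicQuotient → ℂ) =ᵐ[μ] (quasiSplit F E c 3).quotFun (truncation ν 𝓕 T (Ec z)))
    -- the ledger's rows on an open `U` and the candidates `R ⊆ P ∩ U` to remove, each with the `L²` letter (MS-P′)
    {U : Set ℂ} (hUo : IsOpen U) (hEd : ∀ g, DifferentiableOn ℂ (fun z => Ec z g) U) (hE4 : ∀ z ∈ U, Continuous (Ec z))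
    (hEbd : ∀ z₀ ∈ U, ∀ K : Set (quasiSplit F E c 3).Adelic, IsCompact K → ∃ V ∈ 𝓝 z₀, ∃ M : ℝ, ∀ z ∈ V, ∀ g ∈ K, ‖Ec z g‖ ≤ M)
    (hEcinv : ∀ z ∈ U, ∀ (γ : (quasiSplit F E c 3).arithmeticSubgroup) (x : (quasiSplit F E c 3).Adelic), Ec z ((γ : (quasiSplit F E c 3).Adelic) * x) = Ec z x)
    {R : Set ℂ} (hRP : R ⊆ P) (hRU : R ⊆ U) (hMS : ∀ z₀ ∈ R, ∃ C : ℝ, ∀ᶠ z in 𝓝[≠] z₀, ‖Fam z‖ ≤ C) :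
    ∃ Fam' : ℂ → Lp ℂ 2 μ, DifferentiableOn ℂ Fam' (P \ R)ᶜ ∧
      ∀ z : ℂ, z ∉ P \ R → ((Fam' z : Lp ℂ 2 μ) : (quasiSplit F E c 3).automorphicQuotient → ℂ) =ᵐ[μ] (quasiSplit F E c 3).quotFun (truncation ν 𝓕 T (Ec z)) := by
  classical
  -- differentiability of `Fam` at the points of a punctured neighbourhood of any `z₀` (they lie off the closed `P`)
  have hda : ∀ z₀ : ℂ, ∀ᶠ z in 𝓝[≠] z₀, DifferentiableAt ℂ Fam z := fun z₀ =>
    (hPcd z₀).mono fun z hz => hFd.differentiableAt (hPc.isOpen_compl.mem_nhds hz)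
  -- the a.e. rows along punctured neighbourhoods
  have hrows : ∀ z₀ : ℂ, ∀ᶠ z in 𝓝[≠] z₀, ((Fam z : Lp ℂ 2 μ) : (quasiSplit F E c 3).automorphicQuotient → ℂ) =ᵐ[μ]
      (quasiSplit F E c 3).quotFun (truncation ν 𝓕 T (Ec z)) := fun z₀ => (hPcd z₀).mono fun z hz => hFam z hz
  -- pointwise continuity of `z ↦ quotFun (Λ^T (Ec z)) x` at the points of `U` (§2: holomorphy on `U`)
  have hptw : ∀ z₀ ∈ U, ∀ x : (quasiSplit F E c 3).automorphicQuotient,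
      Tendsto (fun z => (quasiSplit F E c 3).quotFun (truncation ν 𝓕 T (Ec z)) x) (𝓝[≠] z₀) (𝓝 ((quasiSplit F E c 3).quotFun (truncation ν 𝓕 T (Ec z₀)) x)) := by
    intro z₀ hz₀ x
    have hd := differentiableOn_truncation_apply_of_rows ν h𝓕 h𝓕c hT Ec hUo hEd hE4 hEbd hEcinv
      (Quotient.out (x : (quasiSplit F E c 3).Adelic ⧸ (quasiSplit F E c 3).quotientSubgroup))⁻¹
    exact ((hd.differentiableAt (hUo.mem_nhds hz₀)).continuousAt.tendsto).mono_left nhdsWithin_le_nhds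
  -- the a.e. value of the punctured `L²`-limit at a removed point
  have hval : ∀ z₀ ∈ R, ((limUnder (𝓝[≠] z₀) Fam : Lp ℂ 2 μ) : (quasiSplit F E c 3).automorphicQuotient → ℂ) =ᵐ[μ]
      (quasiSplit F E c 3).quotFun (truncation ν 𝓕 T (Ec z₀)) := fun z₀ hz₀ =>
    coeFn_limUnder_ae_eq_of_ae_tendsto Fam (hda z₀) (hMS z₀ hz₀) (fun z => (quasiSplit F E c 3).quotFun (truncation ν 𝓕 T (Ec z))) (hrows z₀)
      (ae_of_all _ fun x => hptw z₀ (hRU hz₀) x)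
  -- the shrunk family
  refine ⟨fun z => if z ∈ R then limUnder (𝓝[≠] z) Fam else Fam z, fun z hz => ?_, fun z hz => ?_⟩
  · -- differentiability on `(P ∖ R)ᶜ`
    by_cases hzR : z ∈ R
    · -- at a removed point: the family agrees near `z` with `update Fam z (limUnder …)`
      have hev : (fun w => if w ∈ R then limUnder (𝓝[≠] w) Fam else Fam w) =ᶠ[𝓝 z] update Fam z (limUnder (𝓝[≠] z) Fam) := by
        have h1 : ∀ᶠ w in 𝓝 z, w ≠ z → w ∉ P := eventually_nhdsWithin_iff.1 (hPcd z)
        filter_upwards [h1] with w hw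
        by_cases hwz : w = z
        · subst hwz; simp [hzR]
        · rw [update_of_ne hwz, if_neg fun hwR => hw hwz (hRP hwR)]
      exact ((differentiableAt_update_limUnder_of_eventually_bounded (hda z) (hMS z hzR)).congr_of_eventuallyEq hev).differentiableWithinAt
    · -- off `R`, hence off `P`: the family agrees near `z` with `Fam`
      have hzP : z ∉ P := fun hzP => hz ⟨hzP, hzR⟩
      have hev : (fun w => if w ∈ R then limUnder (𝓝[≠] w) Fam else Fam w) =ᶠ[𝓝 z] Fam := by
        filter_upwards [hPc.isOpen_compl.mem_nhds hzP] with w hw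
        rw [if_neg fun hwR => hw (hRP hwR)]
      exact ((hFd.differentiableAt (hPc.isOpen_compl.mem_nhds hzP)).congr_of_eventuallyEq hev).differentiableWithinAt
  · -- the a.e. rows on `(P ∖ R)ᶜ`
    by_cases hzR : z ∈ R
    · simp only [if_pos hzR]; exact hval z hzR
    · simp only [if_neg hzR]; exact hFam z fun hzP => hz ⟨hzP, hzR⟩

/-- **THE SHRUNK POLE SET KEEPS THE EXPORTS' BOOKKEEPING CLAUSES**: for `P` closed, co-discrete, `⊆ {Re ≤ 2}` and `U` open, `P ∖ (P ∩ U) = P ∖ U` is closed, co-discrete and `⊆ {Re ≤ 2}`;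
and if `U ⊆ {1 < Re}` contains every point of `{1 < Re}` outside a set `S`, then `(P ∖ U) ∩ {1 < Re} ⊆ S` — ★ (C4)'s `hPS` for the shrunk set, BY CONSTRUCTION.
[cite: BernsteinLapid2019, Thm 2.3] -/
theorem poleSet_shrink_clauses {P U S : Set ℂ} (hPc : IsClosed P) (hPcd : ∀ z₀ : ℂ, ∀ᶠ s in 𝓝[≠] z₀, s ∉ P) (hPre : ∀ z ∈ P, z.re ≤ 2)
    (hUo : IsOpen U) (hUS : {z : ℂ | 1 < z.re} \ S ⊆ U) :
    IsClosed (P \ U) ∧ (∀ z₀ : ℂ, ∀ᶠ s in 𝓝[≠] z₀, s ∉ P \ U) ∧ (∀ z ∈ P \ U, z.re ≤ 2) ∧ (P \ U) ∩ {z : ℂ | 1 < z.re} ⊆ S :=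
  ⟨hPc.sdiff hUo, fun z₀ => (hPcd z₀).mono fun _ hs hs' => hs hs'.1, fun z hz => hPre z hz.1,
    fun _ hz => by_contra fun hzS => hz.1.2 (hUS ⟨hz.2, hzS⟩)⟩

end Shrink

end Summit.HodgeConjecture.HodgeConjecture.Cruxes.H413.K2E1ChiTruncatedFamilyRemovableCMThree

end
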